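import Mathlib.Analysis.Calculus.BumpFunction.SmoothApprox
import Summits.AtomisticToContinuum.HydrodynamicLimit.Theorems.BoxDissipativeWeakStrongDefs
import Summits.AtomisticToContinuum.HydrodynamicLimit.Theorems.JaynesSqueezeBlockGibbsToRelEntropyEntropyConservation
import Literature.Analysis.FunctionSpaces.TorusSpaceTimeFields

/-!
# Crux `EntropyAdmissibility` (stmt-AtomisticToContinuum-9903), line `registered` — stub `stub_clampedRenormalizedEntropyConservation` (FS2b)

FS2b of the lead's skeleton: the weak renormalised entropy CONSERVATION identity of a classical
hard-sphere-Euler solution in the analytic band,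
`∫_{(0,τ]} ∫ (ρ Z(s) ∂ₜφ + Z(s) ⟪ρu, ∇φ⟫) dx dt − ∫ ρ Z(s) φ|_τ + ∫ ρ Z(s) φ|_0 = 0`,
`s = 3/2 log θ − log ρ − f_ex(ρσ³)`, passes from smooth renormalisations `Z` (FS2a, the hypothesis
`Sig.stub_smoothRenormalizedEntropyConservation`) to the Lipschitz clamp
`Z_{a,b} = Literature.Analysis.FluidPDE.CompressibleEuler.clamp a b = a ∨ (· ∧ b)`.

Proof (real analysis only).
* The clamp is `1`-Lipschitz (`BDWS.abs_clamp_sub_clamp_le`), hence uniformly continuous, hence for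
  every `ε > 0` there is a `C^∞` function `Z_ε` with `|Z_ε − Z_{a,b}| ≤ ε` everywhere (mollification by a
  normalised bump, Mathlib's `UniformContinuous.exists_contDiff_dist_le`, which packages
  `ContDiffBump.dist_normed_convolution_le` and `HasCompactSupport.contDiff_convolution_left`).
* The tested functional `L(W) = ∫_{(0,τ]}∫ (ρ W(s) ∂ₜφ + W(s) q) − ∫ ρ W(s) φ|_τ + ∫ ρ W(s) φ|_0`
  (`q = ⟪ρu, ∇φ⟫`) is Lipschitz in the sup norm of `W` along continuous `W`:
  `|L(W) − L(W')| ≤ (τ K + 2B) sup|W − W'|`, `K = sup_{[0,τ]×𝕋³} |ρ ∂ₜφ + q|`, `B = sup |ρ φ|`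
  (the fields have continuous space–time lifts on `[0,T) ⊇ [0,τ]`, so they are bounded there,
  `Torus.exists_norm_le_of_continuousOn_of_isCompact`; the slices are continuous on the compact torus,
  hence integrable, and `t ↦ ∫ (…) dx` is continuous on `[0,τ]` by the tube lemma,
  `Torus.continuousOn_integral_of_continuousOn_stLift`, hence integrable on `(0,τ]`; then
  `|∫ f − ∫ g| ≤ ∫ |f − g| ≤ sup |f − g|` on the probability space `𝕋³` and on `(0,τ]`).
* `L(Z_ε) = 0` by FS2a, so `|L(Z_{a,b})| ≤ (τK + 2B) ε` for every `ε > 0`, i.e. `L(Z_{a,b}) = 0`.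
The entropy field `s` is jointly smooth on the band (`JaynesSqueezeClosure.isSmoothSpaceTimeOn_comp_of_mem`
with the smoothness of `(r, ϑ) ↦ 3/2 log ϑ − log r − f_ex(rσ³)` on `{0 < rσ³ < η₀} × {ϑ > 0}`).
References: J. Březina, E. Feireisl, J. Math. Soc. Japan 70 (2018), Def. 2.9, §3.2 (renormalised
entropy balance, clamps); L. C. Evans, *Partial Differential Equations* (2010), App. C.4 Thm. 7
(mollifiers).
-/

noncomputable section

open MeasureTheory Filter Set
open scoped Topology ContDiff

namespace Summit.AtomisticToContinuum.HydrodynamicLimit.Theorems.EABirthFS2b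

open Literature.MathematicalPhysics.KineticTheory
open Literature.Analysis.FluidPDE.CompressibleEuler (clamp continuous_clamp)
open Literature.Analysis.FunctionSpaces Literature.Analysis.FunctionSpaces.Torus
open Summit.AtomisticToContinuum.HydrodynamicLimit.Theorems.BDWS (abs_clamp_sub_clamp_le)
open Summit.AtomisticToContinuum.HydrodynamicLimit.Theorems.JaynesSqueezeClosure
  (isSmoothSpaceTimeOn_comp_of_mem)

/-! ## Smooth uniform approximation of `1`-Lipschitz functions -/

/-- A `1`-Lipschitz real function is a uniform limit of `C^∞` functions (mollification;
Mathlib's `UniformContinuous.exists_contDiff_dist_le`). -/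
theorem exists_contDiff_abs_sub_le {f : ℝ → ℝ} (hf : ∀ x y, |f x - f y| ≤ |x - y|) {ε : ℝ}
    (hε : 0 < ε) : ∃ g : ℝ → ℝ, ContDiff ℝ ∞ g ∧ ∀ x, |g x - f x| ≤ ε := by
  have hL : LipschitzWith 1 f := LipschitzWith.mk_one fun x y => by
    rw [Real.dist_eq, Real.dist_eq]; exact hf x y
  obtain ⟨g, hg, hgf⟩ := hL.uniformContinuous.exists_contDiff_dist_le hε
  exact ⟨g, hg, fun x => by rw [← Real.dist_eq]; exact (hgf x).le⟩

/-- The clamp `Z_{a,b}` is a uniform limit of `C^∞` functions. -/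
theorem exists_contDiff_abs_sub_clamp_le (a b : ℝ) {ε : ℝ} (hε : 0 < ε) :
    ∃ Z : ℝ → ℝ, ContDiff ℝ ∞ Z ∧ ∀ v, |Z v - clamp a b v| ≤ ε :=
  exists_contDiff_abs_sub_le (fun x y => abs_clamp_sub_clamp_le a b x y) hε

/-! ## The tested renormalised functional and its stability in the renormalisation -/

/-- The tested renormalised balance functional of the fields `r` (density), `s` (entropy),
`p` (`∂ₜφ`), `q` (`⟪ρu, ∇φ⟫`) and `φ` (test function), as a function of the renormalisation `W`:
`L(W) = ∫_{(0,τ]} ∫ (r W(s) p + W(s) q) − ∫ r W(s) φ|_τ + ∫ r W(s) φ|_0`. -/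
def renFun (τ : ℝ) (r s p q φ : ℝ → T3 → ℝ) (W : ℝ → ℝ) : ℝ :=
  (∫ t in Ioc 0 τ, ∫ x, (r t x * W (s t x) * p t x + W (s t x) * q t x)) -
    (∫ x, r τ x * W (s τ x) * φ τ x) + ∫ x, r 0 x * W (s 0 x) * φ 0 x

variable {S : Set ℝ} {τ : ℝ} {r s p q φ : ℝ → T3 → ℝ}

/-- The bulk integrand `r W(s) p + W(s) q` has a continuous space–time lift for continuous `W`. -/
theorem continuousOn_stLift_bulk (hr : ContinuousOn (stLift r) (S ×ˢ univ))
    (hs : ContinuousOn (stLift s) (S ×ˢ univ)) (hp : ContinuousOn (stLift p) (S ×ˢ univ))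
    (hq : ContinuousOn (stLift q) (S ×ˢ univ)) {W : ℝ → ℝ} (hW : Continuous W) :
    ContinuousOn (stLift fun t x => r t x * W (s t x) * p t x + W (s t x) * q t x) (S ×ˢ univ) :=
  ((hr.mul (hW.comp_continuousOn hs)).mul hp).add ((hW.comp_continuousOn hs).mul hq)

/-- The boundary integrand `r W(s) φ` has a continuous space–time lift for continuous `W`. -/
theorem continuousOn_stLift_bdry (hr : ContinuousOn (stLift r) (S ×ˢ univ))
    (hs : ContinuousOn (stLift s) (S ×ˢ univ)) (hφ : ContinuousOn (stLift φ) (S ×ˢ univ))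
    {W : ℝ → ℝ} (hW : Continuous W) :
    ContinuousOn (stLift fun t x => r t x * W (s t x) * φ t x) (S ×ˢ univ) :=
  (hr.mul (hW.comp_continuousOn hs)).mul hφ

/-- On the probability space `𝕋³`, space integrals of two continuous slices that are uniformly
`δ`-close are `δ`-close. -/
theorem abs_integral_sub_integral_le {f g : T3 → ℝ} (hf : Continuous f) (hg : Continuous g) {δ : ℝ}
    (h : ∀ x, |f x - g x| ≤ δ) : |(∫ x, f x) - ∫ x, g x| ≤ δ := by
  rw [← integral_sub hf.integrable_unitAddTorus hg.integrable_unitAddTorus]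
  have h1 := norm_integral_le_of_norm_le_const (μ := (volume : Measure T3)) (C := δ)
    (f := fun x => f x - g x) (Eventually.of_forall fun x => by rw [Real.norm_eq_abs]; exact h x)
  simpa only [probReal_univ, mul_one, Real.norm_eq_abs] using h1

/-- **Stability of the tested functional in the renormalisation.** If the fields have continuous
space–time lifts on `S ⊇ [0, τ]`, there is `C` with `|L(W) − L(W')| ≤ C δ` whenever `W, W'` are
continuous and `|W − W'| ≤ δ` everywhere. -/
theorem exists_abs_renFun_sub_le (hτ : 0 ≤ τ) (hS : Icc 0 τ ⊆ S)
    (hr : ContinuousOn (stLift r) (S ×ˢ univ)) (hs : ContinuousOn (stLift s) (S ×ˢ univ))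
    (hp : ContinuousOn (stLift p) (S ×ˢ univ)) (hq : ContinuousOn (stLift q) (S ×ˢ univ))
    (hφ : ContinuousOn (stLift φ) (S ×ˢ univ)) :
    ∃ C : ℝ, ∀ (W W' : ℝ → ℝ) (δ : ℝ), Continuous W → Continuous W' →
      (∀ v, |W v - W' v| ≤ δ) → |renFun τ r s p q φ W - renFun τ r s p q φ W'| ≤ C * δ := by
  -- uniform bounds on the compact `[0, τ] × 𝕋³`
  obtain ⟨K, hK⟩ := exists_norm_le_of_continuousOn_of_isCompact (u := fun t x => r t x * p t x + q t x)
    ((hr.mul hp).add hq) isCompact_Icc hS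
  obtain ⟨B, hB⟩ := exists_norm_le_of_continuousOn_of_isCompact (u := fun t x => r t x * φ t x)
    (hr.mul hφ) isCompact_Icc hS
  have hK' : ∀ t ∈ Icc 0 τ, ∀ x, |r t x * p t x + q t x| ≤ K := fun t ht x => by
    simpa [Real.norm_eq_abs] using hK t ht x
  have hB' : ∀ t ∈ Icc 0 τ, ∀ x, |r t x * φ t x| ≤ B := fun t ht x => by
    simpa [Real.norm_eq_abs] using hB t ht x
  refine ⟨τ * K + 2 * B, fun W W' δ hW hW' hδ => ?_⟩
  have hδ0 : 0 ≤ δ := (abs_nonneg _).trans (hδ 0)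
  have h0 : (0 : ℝ) ∈ Icc 0 τ := ⟨le_rfl, hτ⟩
  have hτm : τ ∈ Icc 0 τ := ⟨hτ, le_rfl⟩
  -- slice estimates
  have hslice : ∀ t ∈ Icc 0 τ, |(∫ x, (r t x * W (s t x) * p t x + W (s t x) * q t x)) -
      ∫ x, (r t x * W' (s t x) * p t x + W' (s t x) * q t x)| ≤ δ * K := by
    intro t ht
    refine abs_integral_sub_integral_le
      (continuous_slice_of_continuousOn_stLift (continuousOn_stLift_bulk hr hs hp hq hW) (hS ht))
      (continuous_slice_of_continuousOn_stLift (continuousOn_stLift_bulk hr hs hp hq hW') (hS ht))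
      fun x => ?_
    have e : r t x * W (s t x) * p t x + W (s t x) * q t x - (r t x * W' (s t x) * p t x + W' (s t x) * q t x) =
        (W (s t x) - W' (s t x)) * (r t x * p t x + q t x) := by ring
    rw [e, abs_mul]
    exact mul_le_mul (hδ _) (hK' t ht x) (abs_nonneg _) hδ0
  have hbdry : ∀ t ∈ Icc 0 τ,
      |(∫ x, r t x * W (s t x) * φ t x) - ∫ x, r t x * W' (s t x) * φ t x| ≤ δ * B := by
    intro t ht
    refine abs_integral_sub_integral_le
      (continuous_slice_of_continuousOn_stLift (continuousOn_stLift_bdry hr hs hφ hW) (hS ht))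
      (continuous_slice_of_continuousOn_stLift (continuousOn_stLift_bdry hr hs hφ hW') (hS ht))
      fun x => ?_
    have e : r t x * W (s t x) * φ t x - r t x * W' (s t x) * φ t x =
        (W (s t x) - W' (s t x)) * (r t x * φ t x) := by ring
    rw [e, abs_mul]
    exact mul_le_mul (hδ _) (hB' t ht x) (abs_nonneg _) hδ0
  -- the bulk term: `t ↦ ∫ (…) dx` is continuous on `[0, τ]`, hence integrable on `(0, τ]`
  have hint : ∀ {V : ℝ → ℝ}, Continuous V →
      IntegrableOn (fun t => ∫ x, (r t x * V (s t x) * p t x + V (s t x) * q t x)) (Ioc 0 τ) := by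
    intro V hV
    have hc : ContinuousOn (fun t => ∫ x, (r t x * V (s t x) * p t x + V (s t x) * q t x)) (Icc 0 τ) :=
      continuousOn_integral_of_continuousOn_stLift
        ((continuousOn_stLift_bulk hr hs hp hq hV).mono (prod_mono hS subset_rfl))
    exact hc.integrableOn_Icc.mono_set Ioc_subset_Icc_self
  have hbulk : |(∫ t in Ioc 0 τ, ∫ x, (r t x * W (s t x) * p t x + W (s t x) * q t x)) -
      ∫ t in Ioc 0 τ, ∫ x, (r t x * W' (s t x) * p t x + W' (s t x) * q t x)| ≤ δ * K * τ := by
    rw [← integral_sub (hint hW) (hint hW')]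
    have h := norm_setIntegral_le_of_norm_le_const (μ := (volume : Measure ℝ)) (s := Ioc 0 τ) (C := δ * K)
      (f := fun t => (∫ x, (r t x * W (s t x) * p t x + W (s t x) * q t x)) -
        ∫ x, (r t x * W' (s t x) * p t x + W' (s t x) * q t x))
      measure_Ioc_lt_top fun t ht => by rw [Real.norm_eq_abs]; exact hslice t (Ioc_subset_Icc_self ht)
    rwa [Real.volume_real_Ioc_of_le hτ, sub_zero, Real.norm_eq_abs] at h
  -- assemble
  have h1 := hbdry τ hτm
  have h2 := hbdry 0 h0
  unfold renFun
  calc _ = |((∫ t in Ioc 0 τ, ∫ x, (r t x * W (s t x) * p t x + W (s t x) * q t x)) -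
          ∫ t in Ioc 0 τ, ∫ x, (r t x * W' (s t x) * p t x + W' (s t x) * q t x)) -
        ((∫ x, r τ x * W (s τ x) * φ τ x) - ∫ x, r τ x * W' (s τ x) * φ τ x) +
        ((∫ x, r 0 x * W (s 0 x) * φ 0 x) - ∫ x, r 0 x * W' (s 0 x) * φ 0 x)| := by ring_nf
    _ ≤ δ * K * τ + δ * B + δ * B := by
        refine (abs_add_le _ _).trans (add_le_add ((abs_sub _ _).trans (add_le_add hbulk h1)) h2)
    _ = (τ * K + 2 * B) * δ := by ring

/-- **Passage to the limit in the renormalisation.** If the tested functional vanishes for every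
`C^∞` renormalisation, it vanishes for every continuous renormalisation that is a uniform limit of
`C^∞` functions. -/
theorem renFun_eq_zero_of_forall_contDiff (hτ : 0 ≤ τ) (hS : Icc 0 τ ⊆ S)
    (hr : ContinuousOn (stLift r) (S ×ˢ univ)) (hs : ContinuousOn (stLift s) (S ×ˢ univ))
    (hp : ContinuousOn (stLift p) (S ×ˢ univ)) (hq : ContinuousOn (stLift q) (S ×ˢ univ))
    (hφ : ContinuousOn (stLift φ) (S ×ˢ univ)) {W : ℝ → ℝ} (hW : Continuous W)
    (happrox : ∀ ε : ℝ, 0 < ε → ∃ Z : ℝ → ℝ, ContDiff ℝ ∞ Z ∧ ∀ v, |Z v - W v| ≤ ε)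
    (hZ : ∀ Z : ℝ → ℝ, ContDiff ℝ ∞ Z → renFun τ r s p q φ Z = 0) :
    renFun τ r s p q φ W = 0 := by
  obtain ⟨C, hC⟩ := exists_abs_renFun_sub_le hτ hS hr hs hp hq hφ
  have key : ∀ ε : ℝ, 0 < ε → |renFun τ r s p q φ W| ≤ C * ε := fun ε hε => by
    obtain ⟨Z, hZs, hZW⟩ := happrox ε hε
    have h := hC W Z ε hW hZs.continuous fun v => by rw [abs_sub_comm]; exact hZW v
    rwa [hZ Z hZs, sub_zero] at h
  have hC0 : 0 ≤ C := by
    have h := key 1 one_pos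
    rw [mul_one] at h
    exact (abs_nonneg _).trans h
  have h0 : |renFun τ r s p q φ W| ≤ 0 := by
    refine le_of_forall_pos_le_add fun ε hε => ?_
    have h := key (ε / (C + 1)) (by positivity)
    rw [zero_add]
    refine h.trans ?_
    rw [mul_div_assoc', div_le_iff₀ (by positivity)]
    nlinarith
  exact abs_nonpos_iff.1 h0

/-! ## The entropy field of a classical solution in the band -/

/-- The hard-sphere entropy per particle `(r, ϑ) ↦ 3/2 log ϑ − log r − f_ex(rσ³)` is smooth on the band
`{0 < rσ³ < η₀} × {ϑ > 0}` when `f_ex` is smooth on `(0, η₀)`. -/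
theorem contDiffOn_entropy_band {σ η₀ : ℝ} (hf : ContDiffOn ℝ ∞ hsExcessFreeEnergy (Ioo 0 η₀)) :
    ContDiffOn ℝ ∞ (Function.uncurry fun a b : ℝ =>
        3 / 2 * Real.log b - Real.log a - hsExcessFreeEnergy (a * σ ^ 3))
      {q : ℝ × ℝ | q.1 * σ ^ 3 ∈ Ioo 0 η₀ ∧ 0 < q.2} := by
  have hη : ContDiffOn ℝ ∞ (fun q : ℝ × ℝ => q.1 * σ ^ 3)
      {q : ℝ × ℝ | q.1 * σ ^ 3 ∈ Ioo 0 η₀ ∧ 0 < q.2} := contDiffOn_fst.mul contDiffOn_const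
  have hmaps : MapsTo (fun q : ℝ × ℝ => q.1 * σ ^ 3) {q : ℝ × ℝ | q.1 * σ ^ 3 ∈ Ioo 0 η₀ ∧ 0 < q.2}
      (Ioo 0 η₀) := fun q hq => hq.1
  have h1 : ∀ q ∈ {q : ℝ × ℝ | q.1 * σ ^ 3 ∈ Ioo 0 η₀ ∧ 0 < q.2}, q.1 ≠ 0 := by
    intro q hq h0
    have := hq.1.1
    rw [h0, zero_mul] at this
    exact lt_irrefl _ this
  have h2 : ∀ q ∈ {q : ℝ × ℝ | q.1 * σ ^ 3 ∈ Ioo 0 η₀ ∧ 0 < q.2}, q.2 ≠ 0 := fun q hq => hq.2.ne'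
  have h : (Function.uncurry fun a b : ℝ => 3 / 2 * Real.log b - Real.log a - hsExcessFreeEnergy (a * σ ^ 3)) =
      fun q : ℝ × ℝ => 3 / 2 * Real.log q.2 - Real.log q.1 - hsExcessFreeEnergy (q.1 * σ ^ 3) := by
    funext q; rfl
  rw [h]
  exact ((contDiffOn_const.mul (contDiffOn_snd.log h2)).sub (contDiffOn_fst.log h1)).sub (hf.comp hη hmaps)

/-! ## The stub -/

/-- FS2a (verbatim the skeleton's). -/
def Sig.stub_smoothRenormalizedEntropyConservation : Prop :=
  ∀ (σ η₀ : ℝ), 0 < σ → 0 < η₀ → ContDiffOn ℝ ∞ hsExcessFreeEnergy (Ioo 0 η₀) →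
    ∀ (T : ℝ) (ρ θ : ℝ → T3 → ℝ) (u : ℝ → T3 → V3), IsHardSphereEulerSolution σ T ρ u θ →
      (∀ t ∈ Ico 0 T, ∀ x, ρ t x * σ ^ 3 < η₀) →
      ∀ Z : ℝ → ℝ, ContDiff ℝ ∞ Z →
      ∀ τ ∈ Ico 0 T, ∀ φ : ℝ → T3 → ℝ, Literature.Analysis.FunctionSpaces.Torus.IsSmoothSpaceTimeOn (Ico 0 T) φ →
        (∫ t in Ioc 0 τ, ∫ x,
            (ρ t x * Z (3 / 2 * Real.log (θ t x) - Real.log (ρ t x) - hsExcessFreeEnergy (ρ t x * σ ^ 3)) *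
                Literature.Analysis.FunctionSpaces.Torus.timeDerivWithin (Ico 0 T) φ t x +
              Z (3 / 2 * Real.log (θ t x) - Real.log (ρ t x) - hsExcessFreeEnergy (ρ t x * σ ^ 3)) *
                inner ℝ (ρ t x • u t x) (Literature.Analysis.FunctionSpaces.Torus.gradient (φ t) x))) -
          (∫ x, ρ τ x * Z (3 / 2 * Real.log (θ τ x) - Real.log (ρ τ x) - hsExcessFreeEnergy (ρ τ x * σ ^ 3)) * φ τ x) +
          ∫ x, ρ 0 x * Z (3 / 2 * Real.log (θ 0 x) - Real.log (ρ 0 x) - hsExcessFreeEnergy (ρ 0 x * σ ^ 3)) * φ 0 x = 0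

/-- FS2b (verbatim the skeleton's). -/
def Sig.stub_clampedRenormalizedEntropyConservation : Prop :=
  Sig.stub_smoothRenormalizedEntropyConservation →
  ∀ (σ η₀ : ℝ), 0 < σ → 0 < η₀ → ContDiffOn ℝ ∞ hsExcessFreeEnergy (Ioo 0 η₀) →
    ∀ (T : ℝ) (ρ θ : ℝ → T3 → ℝ) (u : ℝ → T3 → V3), IsHardSphereEulerSolution σ T ρ u θ →
      (∀ t ∈ Ico 0 T, ∀ x, ρ t x * σ ^ 3 < η₀) →
      ∀ a b : ℝ, a < b →
      ∀ τ ∈ Ico 0 T, ∀ φ : ℝ → T3 → ℝ, Literature.Analysis.FunctionSpaces.Torus.IsSmoothSpaceTimeOn (Ico 0 T) φ →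
        (∫ t in Ioc 0 τ, ∫ x,
            (ρ t x * clamp a b (3 / 2 * Real.log (θ t x) - Real.log (ρ t x) - hsExcessFreeEnergy (ρ t x * σ ^ 3)) *
                Literature.Analysis.FunctionSpaces.Torus.timeDerivWithin (Ico 0 T) φ t x +
              clamp a b (3 / 2 * Real.log (θ t x) - Real.log (ρ t x) - hsExcessFreeEnergy (ρ t x * σ ^ 3)) *
                inner ℝ (ρ t x • u t x) (Literature.Analysis.FunctionSpaces.Torus.gradient (φ t) x))) -
          (∫ x, ρ τ x * clamp a b (3 / 2 * Real.log (θ τ x) - Real.log (ρ τ x) - hsExcessFreeEnergy (ρ τ x * σ ^ 3)) *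
              φ τ x) +
          ∫ x, ρ 0 x * clamp a b (3 / 2 * Real.log (θ 0 x) - Real.log (ρ 0 x) - hsExcessFreeEnergy (ρ 0 x * σ ^ 3)) *
              φ 0 x = 0

/-- **Stub FS2b** (crux stmt-AtomisticToContinuum-9903, line `registered`): the weak renormalised
entropy conservation identity of a classical hard-sphere-Euler solution in the analytic band for the
Lipschitz clamp `Z_{a,b}`, from the smooth-renormalisation identity FS2a by mollification of the clamp
and passage to the limit. -/
theorem stub_clampedRenormalizedEntropyConservation : Sig.stub_clampedRenormalizedEntropyConservation := by
  intro hFS σ η₀ hσ hη₀ hf T ρ θ u hE hband a b _hab τ hτ φ hφ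
  have hU : UniqueDiffOn ℝ (Ico 0 T) := uniqueDiffOn_Ico 0 T
  have hsub : Icc 0 τ ⊆ Ico 0 T := fun t ht => ⟨ht.1, ht.2.trans_lt hτ.2⟩
  have hmem : ∀ t ∈ Ico 0 T, ∀ x, (ρ t x, θ t x) ∈ {q : ℝ × ℝ | q.1 * σ ^ 3 ∈ Ioo 0 η₀ ∧ 0 < q.2} :=
    fun t ht x => ⟨⟨mul_pos (hE.density_pos t ht x) (pow_pos hσ 3), hband t ht x⟩, hE.temperature_pos t ht x⟩
  have hsm : IsSmoothSpaceTimeOn (Ico 0 T)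
      (fun t y => 3 / 2 * Real.log (θ t y) - Real.log (ρ t y) - hsExcessFreeEnergy (ρ t y * σ ^ 3)) :=
    isSmoothSpaceTimeOn_comp_of_mem
      (g := fun a b : ℝ => 3 / 2 * Real.log b - Real.log a - hsExcessFreeEnergy (a * σ ^ 3))
      (contDiffOn_entropy_band hf) hE.smooth_density hE.smooth_temperature hmem
  have hp : IsSmoothSpaceTimeOn (Ico 0 T) (Torus.timeDerivWithin (Ico 0 T) φ) := hφ.timeDerivWithin hU
  have hq : IsSmoothSpaceTimeOn (Ico 0 T) (fun t y => inner ℝ (ρ t y • u t y) (Torus.gradient (φ t) y)) :=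
    (hE.smooth_density.smul hE.smooth_velocity).inner (hφ.gradient hU)
  exact renFun_eq_zero_of_forall_contDiff (S := Ico 0 T) (r := ρ)
    (s := fun t y => 3 / 2 * Real.log (θ t y) - Real.log (ρ t y) - hsExcessFreeEnergy (ρ t y * σ ^ 3))
    (p := Torus.timeDerivWithin (Ico 0 T) φ)
    (q := fun t y => inner ℝ (ρ t y • u t y) (Torus.gradient (φ t) y)) (φ := φ)
    hτ.1 hsub hE.smooth_density.continuousOn_stLift hsm.continuousOn_stLift hp.continuousOn_stLift
    hq.continuousOn_stLift hφ.continuousOn_stLift (continuous_clamp a b)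
    (fun ε hε => exists_contDiff_abs_sub_clamp_le a b hε)
    (fun Z hZ => hFS σ η₀ hσ hη₀ hf T ρ θ u hE hband Z hZ τ hτ φ hφ)

end Summit.AtomisticToContinuum.HydrodynamicLimit.Theorems.EABirthFS2b

end
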